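import Summits.BirchSwinnertonDyer.BirchSwinnertonDyer.Theorems.ByReductionTypeAtTwoOrdKatoHalfAtTwoIsoZetaColemanMuIotaAdjointPairing
import HarnessLib

/-!
# Route ByReductionTypeAtTwo, crux `OrdKatoHalfAtTwoIso` (stmt-BirchSwinnertonDyer-19573), line `steinberg-fibre-at-two`,
# F1 slot (child stmt-BirchSwinnertonDyer-23959): the SELMER SIDE of the weak local input is KERNEL — the local group `S`, its
# two keys `ψ, ψ⁻` and `φ = loc₂` are CONSTRUCTED (`H¹(ℚ_∞, E[2^∞]) ⧸ ker res_{v₂}` with the descended `conj_γ^{±1} − 1`), so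
# the typed input at `2` is a pairing of the local Iwasawa module AGAINST THE GLOBAL CLASSES THROUGH `loc₂`: adjoint for
# `γ ↔ γ⁻¹`, `ℤ₂`-bilinear, onto the `loc₂`-characters; a Coleman map with isotropic kernel and the ERL shape; reciprocity

Seat `cruxlead-stmt-BirchSwinnertonDyer-19573-w3` g3 (prover WIDTH under the LEAD `cruxlead-19573` g5; HOME
`run/shared/lean/pub/bsd-2adic/`; `--supports` stmt-BirchSwinnertonDyer-23959). THEOREMS ONLY (no definition, no named fact,
no `sorry`, no instance). HONEST FRAMING (cell bsd-2adic): BSD is not proved by any of this; F1μι⁻, the direct `0 < Δ` child,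
B7′ and the crux are NOT proved here; every theorem is a KERNEL implication over explicit hypotheses.

WHY. The weak door `zetaColemanMuTheta_invol_datum_of_adjointPairing_locOne_erl` (`…IotaAdjointPairing`) still lets the typer CHOOSE
the local group `S`, the keys `ψ⁻, ψ` and `φ : Sel → S` (with an intertwining clause and a kernel clause) — exactly the slots where the
`ι`-keying defect of F1μ⁺ was born (w3 g2 IOTA-FINDING, pen RC-383). Here they are FIXED by construction, inside the proofs (no new
definition): `S := H¹(ker κ, E[2^∞]) ⧸ K₀` with `K₀ := ker(res : H¹(ker κ, ·) → H¹(ker κ ⊓ D_{v₂}, ·))` — `K₀` is `conj_σ`-stable for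
every `σ ∈ Γ_ℚ` because `ℚ_∞/ℚ` has ONE prime above `2` (w3 g2 `resOfLe_conjH1_eq_zero_of_isCyclotomic_rat`, p690240) — `ψ^{±} :=`
the descents of `conj_{γ^{±1}} − 1` (inverse keys by `conjH1_mul`/`conjH1_one`), `φ := (mod K₀) ∘ (Sel ↪ H¹)` (kernel clause
definitional, intertwining by `conjSelmerInfty = conjH1|_Sel`). What the typer supplies is then literally: a `Λ`-module `P₀` (print:
`𝐇¹_{loc,Γ}(T₂W)`, tree `LocalIwasawaH1Data`), an additive `toDualP : P₀ → Hom(H¹(ℚ_∞, E[2^∞]), ℚ/ℤ)` FACTORING THROUGH `loc_{v₂}`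
(kills `K₀`), ADJOINT for `γ ↔ γ⁻¹` (`toDualP (T·x) s = toDualP x (conj_{γ⁻¹} s) − toDualP x s`; print: `⟨(γᵥ−1)u, s⟩ = ⟨u, (γᵥ⁻¹−1)s⟩`,
equivariance of the local Tate pairing, and `conj_γ = conj_{res γᵥ}` on `H¹(ker κ)` for NORMALISED generators `κ γ = κ(res γᵥ) = 1`),
`ℤ₂`-BILINEAR on torsion values, and ONTO the characters of `H¹(ℚ_∞, E[2^∞])` that factor through `loc_{v₂}` (Tate local duality at
the layers, Milne ADT I Cor. 2.3, every `p`); a `Λ`-linear `col : P₀ → Λ` whose kernel pairs to zero with `Sel` (Kato 17.12 at `2` +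
`F⁺ ⊥ F⁺`); `ℓ₀ : 𝐇¹ → P₀` (`loc₂`) with reciprocity on the genuine classes (Poitou–Tate); the ERL shape (Kato 12.6/16.6 (2) at `2`, `‖r‖₂ = 1`
on `Δ < 0`, lead F-27a).

* §1 `zetaColemanMuTheta_invol_datum_of_locPairing_erl` — per datum, «F1μ⁺θ» at `θ = ι` from the inputs above (the Selmer side built
  inside the proof, then `…_of_adjointPairing_erl`).
* §2 `hlocNeg` (the §1 hypotheses for every datum on the cell `Δ < 0`) ⇒ `ZetaColemanMuIotaNegDiscAtTwo` BY NAME (lead's def,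
  p693557) ⇒ the post-P8′ child `OrdKatoFineZetaAtTwoResidue` (stmt-24097, rev 41) BY NAME given its `0 < Δ` conjunct (the crux then
  follows by the lead's `ordKatoHalfAtTwoIso_of_iota_halves`, P8′ shape).

References: [Kato2004Asterisque] Thm 12.6 (p. 222), (14.9.3) (p. 240), Thm 16.6 (2) (p. 271), Thm 17.4 (1)(2) (p. 273), Prop 17.11,
Lemma 17.12 (pp. 277–279), §17.13 (pp. 279–280); [MilneADT2006] I Cor. 2.3, I Thm 4.10; [GreenbergLNM1716] §1 p. 60, §2 (p. 72);
[SerreLocalFields1979] VII §5 Prop. 3; [Washington1997] §13.1–13.2; [AbbesUllmo1996] Thm A; tree p682177, p690240, p691108, p693557,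
`…IotaAdjointTranspose` / `…IotaAdjointPairing` (this seat), `…PosDiscSplit` (lead g5).
-/

set_option autoImplicit false
set_option linter.dupNamespace false

noncomputable section

open scoped Classical MatrixGroups ModularForm NumberField
open CongruenceSubgroup WeierstrassCurve Field IsDedekindDomain NumberField
open Literature.NumberTheory.GaloisRepresentations
open Literature.NumberTheory.GaloisCohomology
open Literature.NumberTheory.EllipticCurves Literature.NumberTheory.EllipticCurves.ModularForms
  Literature.NumberTheory.EllipticCurves.GreenbergSelmer
open Literature.NumberTheory.EllipticCurves.Kato2004
  Literature.NumberTheory.EllipticCurves.Kato2004.EulerSystemValues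
open Literature.NumberTheory.EllipticCurves.IwasawaDual
open Literature.NumberTheory.EllipticCurves.Rank1Residual
open Literature.NumberTheory.EllipticCurves.Greenberg1999
open Summit.BirchSwinnertonDyer.Rank1Residual Summit.BirchSwinnertonDyer.Rank1Residual.X5
open Summit.BirchSwinnertonDyer.BirchSwinnertonDyer.Theorems.OrdKatoOptimalAtTwo
  Summit.BirchSwinnertonDyer.BirchSwinnertonDyer.Theorems.OrdKatoIntAtTwo
open Summit.BirchSwinnertonDyer.BirchSwinnertonDyer.Theses.ByReductionTypeAtTwo

namespace Summit.BirchSwinnertonDyer.BirchSwinnertonDyer.Theorems.SteinbergFibreAtTwo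

/-! ## §1 Per datum: the Selmer side of the weak local input is built in the kernel -/

section PerDatum

variable {W : WeierstrassCurve ℚ} [W.IsElliptic] [W.IsGloballyMinimal]
  [ContinuousSMul ℤ_[2] (W.tateModule 2)] [Module.Free ℤ_[2] (W.tateModule 2)]
  [Module.Finite ℤ_[2] (W.tateModule 2)] {N : ℕ} {f : CuspForm (Gamma0 N) 2}
  {κ : ZpExtension ℚ 2} {γ : absoluteGaloisGroup ℚ} {hκ : κ.IsCyclotomic}

/-- **«F1μ⁺θ» at `θ = ι`, per datum, from a pairing of the local module AGAINST THE GLOBAL CLASSES THROUGH `loc₂`.**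
Data/hypotheses (explicit; nothing asserted): the pinned `𝐇¹` `I`, a SET `G ⊆ 𝐇¹` of GENUINE `2`-adic Euler-system classes, a place
`v₂ ∋ 2`; a `Λ`-module `P₀` (print: `𝐇¹_{loc,Γ}(T₂W)`) with an additive `toDualP : P₀ → Hom(H¹(ker κ, E[2^∞]), ℚ/ℤ)` which (K) kills the
classes restricting to zero on `ker κ ⊓ D_{v₂}` (it factors through `loc_{v₂}`), (T) is ADJOINT for `γ ↔ γ⁻¹`
(`toDualP (T·x) s = toDualP x (conj_{γ⁻¹} s) − toDualP x s`), (C) is `ℤ₂`-BILINEAR on torsion values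
(`2^k · toDualP x s = 0 → toDualP (C c · x) s = (c mod 2^k) · toDualP x s`), (S) is ONTO the characters of `H¹(ker κ, E[2^∞])` that kill
`ker res_{v₂}`; a `Λ`-linear `col : P₀ → Λ` whose kernel pairs to zero with `Sel_{2^∞}(E/ℚ_∞)`; a `Λ`-linear `ℓ₀ : 𝐇¹ → P₀` with (R)
`toDualP (ℓ₀ g) s = 0` for `g ∈ G`, `s ∈ Sel`; (E) the ERL shape. CONSTRUCTION (inside the proof): `S := H¹(ker κ, E[2^∞]) ⧸ ker res_{v₂}`
(`conj`-stable: ONE prime of `ℚ_∞` above `2`, p690240), keys `ψ^{±} :=` descended `conj_{γ^{±1}} − 1`, `φ := (mod) ∘ (Sel ↪ H¹)`, the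
descended pairing; then `zetaColemanMuTheta_invol_datum_of_adjointPairing_erl`.
[cite: Kato2004Asterisque, Thm 12.6 (p. 222), (14.9.3) (p. 240), Thm 16.6 (2) (p. 271), Prop 17.11, Lemma 17.12 (pp. 277–279), §17.13 (pp. 279–280)]
[cite: MilneADT2006, Ch. I, Cor. 2.3] [cite: GreenbergLNM1716, §2 (p. 72)] [cite: SerreLocalFields1979, VII §5 Prop. 3] -/
theorem zetaColemanMuTheta_invol_datum_of_locPairing_erl (D : W.SelmerDualData κ γ)
    (Y : W.FineSelmerDualData κ γ) (I : IwasawaH1Data W 2 κ γ) (G : Set I.H)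
    (hG : ∀ g ∈ G, IsEulerSystemClassTwo W hκ I g)
    (v₂ : HeightOneSpectrum (𝓞 ℚ)) (hv₂ : ((2 : ℕ) : 𝓞 ℚ) ∈ v₂.asIdeal)
    {P₀ : Type*} [AddCommGroup P₀] [Module (IwasawaAlgebra 2) P₀]
    (toDualP : P₀ →+ (W.subgroupH1 2 κ.kerSubgroup →+ AddCircle (1 : ℚ)))
    (hK : ∀ (x : P₀) (s : W.subgroupH1 2 κ.kerSubgroup),
      W.resOfLe 2 (inf_le_left : κ.kerSubgroup ⊓ decomp v₂ ≤ κ.kerSubgroup) s = 0 → toDualP x s = 0)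
    (hT : ∀ (x : P₀) (s : W.subgroupH1 2 κ.kerSubgroup),
      toDualP ((PowerSeries.X : IwasawaAlgebra 2) • x) s = toDualP x (W.conjH1 2 κ.kerSubgroup γ⁻¹ s) - toDualP x s)
    (hC : ∀ (c : ℤ_[2]) (x : P₀) (s : W.subgroupH1 2 κ.kerSubgroup) (k : ℕ), 2 ^ k • toDualP x s = 0 →
      toDualP (PowerSeries.C c • x) s = (PadicInt.toZModPow k c).val • toDualP x s)
    (hS : ∀ χ : W.subgroupH1 2 κ.kerSubgroup →+ AddCircle (1 : ℚ),
      (∀ s, W.resOfLe 2 (inf_le_left : κ.kerSubgroup ⊓ decomp v₂ ≤ κ.kerSubgroup) s = 0 → χ s = 0) →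
        ∃ x : P₀, toDualP x = χ)
    (col : P₀ →ₗ[IwasawaAlgebra 2] IwasawaAlgebra 2)
    (hcolφ : ∀ x : P₀, col x = 0 → ∀ s : W.selmerInfty κ, toDualP x s = 0)
    (ℓ₀ : I.H →ₗ[IwasawaAlgebra 2] P₀)
    (hrecG : ∀ g ∈ G, ∀ s : W.selmerInfty κ, toDualP (ℓ₀ g) s = 0)
    (herl : ∃ g ∈ G, ∃ (u : (IwasawaAlgebra 2)ˣ) (M L' : IwasawaAlgebra 2) (r : ℚ_[2]),
      M ∉ IwasawaAlgebra.augIdealP 2 ∧ ‖r‖ = 1 ∧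
        iwasawaToPowerSeries 2 L' = PowerSeries.C r * padicLFunction f (unitRoot W 2 : ℚ_[2]) ∧
        col (ℓ₀ g) = (u : IwasawaAlgebra 2) * M * L') :
    ∃ (Z : Submodule (IwasawaAlgebra 2) I.H) (P : Submodule (IwasawaAlgebra 2) (IwasawaAlgebra 2))
      (ℓ : I.H →ₗ[IwasawaAlgebra 2] P)
      (τ : P →ₛₗ[((IwasawaAlgebra.involEquiv 2).toRingEquiv : IwasawaAlgebra 2 →+* IwasawaAlgebra 2)] D.X)
      (π : D.X →ₗ[IwasawaAlgebra 2] Y.X),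
      Z ≤ Submodule.span (IwasawaAlgebra 2) {s : I.H | IsEulerSystemClassTwo W hκ I s} ∧
      (∀ z ∈ Z, τ (ℓ z) = 0) ∧ Function.Surjective π ∧ Function.Exact τ π ∧
      ∀ G₁ : IwasawaAlgebra 2,
        iwasawaToPowerSeries 2 G₁ = padicLFunction f (unitRoot W 2 : ℚ_[2]) →
          ∃ s : IwasawaAlgebra 2, s ∉ IwasawaAlgebra.augIdealP 2 ∧
            s * G₁ ∈ Submodule.map (P.subtype ∘ₗ ℓ) Z := by
  -- the local group `S := H¹(ker κ, E[2^∞]) ⧸ K₀`, `K₀ := ker res_{v₂}` (conj-stable: ONE prime of `ℚ_∞` above `2`)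
  set res₂ : W.subgroupH1 2 κ.kerSubgroup →+ W.subgroupH1 2 (κ.kerSubgroup ⊓ decomp v₂) :=
    W.resOfLe 2 (inf_le_left : κ.kerSubgroup ⊓ decomp v₂ ≤ κ.kerSubgroup) with hres₂
  let K₀ : AddSubgroup (W.subgroupH1 2 κ.kerSubgroup) := res₂.ker
  have hK₀ : ∀ s, s ∈ K₀ ↔ res₂ s = 0 := fun s => AddMonoidHom.mem_ker
  have hstab : ∀ σ : absoluteGaloisGroup ℚ, K₀ ≤ K₀.comap (W.conjH1 2 κ.kerSubgroup σ) := by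
    intro σ s hs
    rw [AddSubgroup.mem_comap, hK₀]
    exact resOfLe_conjH1_eq_zero_of_isCyclotomic_rat (M := W.geomPrimaryTorsion 2) hκ v₂ hv₂ ((hK₀ s).1 hs) σ
  -- the descended conjugations and the two keys
  let cγ : AddMonoid.End (W.subgroupH1 2 κ.kerSubgroup ⧸ K₀) :=
    QuotientAddGroup.map K₀ K₀ (W.conjH1 2 κ.kerSubgroup γ) (hstab γ)
  let cγ' : AddMonoid.End (W.subgroupH1 2 κ.kerSubgroup ⧸ K₀) :=
    QuotientAddGroup.map K₀ K₀ (W.conjH1 2 κ.kerSubgroup γ⁻¹) (hstab γ⁻¹)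
  have hcγ : ∀ s, cγ (QuotientAddGroup.mk s) = QuotientAddGroup.mk (W.conjH1 2 κ.kerSubgroup γ s) :=
    fun s => QuotientAddGroup.map_mk K₀ K₀ _ (hstab γ) s
  have hcγ' : ∀ s, cγ' (QuotientAddGroup.mk s) = QuotientAddGroup.mk (W.conjH1 2 κ.kerSubgroup γ⁻¹ s) :=
    fun s => QuotientAddGroup.map_mk K₀ K₀ _ (hstab γ⁻¹) s
  let ψ : AddMonoid.End (W.subgroupH1 2 κ.kerSubgroup ⧸ K₀) := cγ - 1
  let ψm : AddMonoid.End (W.subgroupH1 2 κ.kerSubgroup ⧸ K₀) := cγ' - 1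
  have hconj_mul : ∀ (σ τ : absoluteGaloisGroup ℚ) (s : W.subgroupH1 2 κ.kerSubgroup),
      W.conjH1 2 κ.kerSubgroup σ (W.conjH1 2 κ.kerSubgroup τ s) = W.conjH1 2 κ.kerSubgroup (σ * τ) s := by
    intro σ τ s
    rw [W.conjH1_mul_holds 2 κ.kerSubgroup σ τ, AddMonoidHom.comp_apply]
  have hconj_one : ∀ s : W.subgroupH1 2 κ.kerSubgroup, W.conjH1 2 κ.kerSubgroup 1 s = s := by
    intro s
    rw [W.conjH1_one_holds 2 κ.kerSubgroup, AddMonoidHom.id_apply]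
  have hψ₁ : (1 + ψm) * (1 + ψ) = 1 := by
    have e1 : (1 + ψm) = cγ' := add_sub_cancel 1 cγ'
    have e2 : (1 + ψ) = cγ := add_sub_cancel 1 cγ
    rw [e1, e2]
    apply QuotientAddGroup.addMonoidHom_ext
    ext s
    change cγ' (cγ (QuotientAddGroup.mk s)) = QuotientAddGroup.mk s
    rw [hcγ, hcγ', hconj_mul, inv_mul_cancel, hconj_one]
  have hψ₂ : (1 + ψ) * (1 + ψm) = 1 := by
    have e1 : (1 + ψm) = cγ' := add_sub_cancel 1 cγ'
    have e2 : (1 + ψ) = cγ := add_sub_cancel 1 cγ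
    rw [e1, e2]
    apply QuotientAddGroup.addMonoidHom_ext
    ext s
    change cγ (cγ' (QuotientAddGroup.mk s)) = QuotientAddGroup.mk s
    rw [hcγ', hcγ, hconj_mul, mul_inv_cancel, hconj_one]
  -- `φ := (mod K₀) ∘ (Sel ↪ H¹)`
  let φ : W.selmerInfty κ →+ W.subgroupH1 2 κ.kerSubgroup ⧸ K₀ :=
    (QuotientAddGroup.mk' K₀).comp (W.selmerInfty κ).subtype
  have hφapply : ∀ s : W.selmerInfty κ, φ s = QuotientAddGroup.mk (s : W.subgroupH1 2 κ.kerSubgroup) := fun s => rfl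
  have hφ : ∀ s, φ ((W.conjSelmerInfty κ γ - 1) s) = ψ (φ s) := by
    intro s
    have hcoe : ((((W.conjSelmerInfty κ γ - 1) s : W.selmerInfty κ)) : W.subgroupH1 2 κ.kerSubgroup) =
        W.conjH1 2 κ.kerSubgroup γ s - (s : W.subgroupH1 2 κ.kerSubgroup) := rfl
    rw [hφapply, hφapply, hcoe, QuotientAddGroup.mk_sub]
    change _ = cγ (QuotientAddGroup.mk (s : W.subgroupH1 2 κ.kerSubgroup)) -
      QuotientAddGroup.mk (s : W.subgroupH1 2 κ.kerSubgroup)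
    rw [hcγ]
  have hφ₁ : ∀ s : W.selmerInfty κ, φ s = 0 ↔ res₂ (s : W.subgroupH1 2 κ.kerSubgroup) = 0 := by
    intro s
    rw [hφapply, QuotientAddGroup.eq_zero_iff, hK₀]
  -- the descended pairing `P₀ → Hom(S, ℚ/ℤ)`
  have hKle : ∀ x : P₀, K₀ ≤ (toDualP x).ker := fun x s hs => by
    rw [AddMonoidHom.mem_ker]
    exact hK x s ((hK₀ s).1 hs)
  let toDualP' : P₀ →+ (W.subgroupH1 2 κ.kerSubgroup ⧸ K₀ →+ AddCircle (1 : ℚ)) :=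
    { toFun := fun x => QuotientAddGroup.lift K₀ (toDualP x) (hKle x)
      map_zero' := by
        apply QuotientAddGroup.addMonoidHom_ext
        ext s
        rw [AddMonoidHom.comp_apply, AddMonoidHom.comp_apply, QuotientAddGroup.mk'_apply, QuotientAddGroup.lift_mk,
          map_zero, AddMonoidHom.zero_apply, AddMonoidHom.zero_apply]
      map_add' := fun x y => by
        apply QuotientAddGroup.addMonoidHom_ext
        ext s
        rw [AddMonoidHom.comp_apply, AddMonoidHom.comp_apply, QuotientAddGroup.mk'_apply, QuotientAddGroup.lift_mk,
          map_add, AddMonoidHom.add_apply, AddMonoidHom.add_apply, QuotientAddGroup.lift_mk,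
          QuotientAddGroup.lift_mk] }
  have hlift : ∀ (x : P₀) (s : W.subgroupH1 2 κ.kerSubgroup),
      toDualP' x (QuotientAddGroup.mk s) = toDualP x s := fun x s => QuotientAddGroup.lift_mk K₀ (hKle x) s
  have hT' : ∀ (x : P₀) (t : W.subgroupH1 2 κ.kerSubgroup ⧸ K₀),
      toDualP' ((PowerSeries.X : IwasawaAlgebra 2) • x) t = toDualP' x (ψm t) := by
    intro x t
    obtain ⟨s, rfl⟩ := QuotientAddGroup.mk_surjective t
    change toDualP' ((PowerSeries.X : IwasawaAlgebra 2) • x) (QuotientAddGroup.mk s) =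
      toDualP' x (cγ' (QuotientAddGroup.mk s) - QuotientAddGroup.mk s)
    rw [hcγ', map_sub, hlift, hlift, hlift, hT]
  have hC' : ∀ (c : ℤ_[2]) (x : P₀) (t : W.subgroupH1 2 κ.kerSubgroup ⧸ K₀) (k : ℕ), 2 ^ k • t = 0 →
      toDualP' (PowerSeries.C c • x) t = (PadicInt.toZModPow k c).val • toDualP' x t := by
    intro c x t k hkt
    obtain ⟨s, rfl⟩ := QuotientAddGroup.mk_surjective t
    have hval : 2 ^ k • toDualP x s = 0 := by
      rw [← hlift, ← map_nsmul, hkt, map_zero]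
    rw [hlift, hlift]
    exact hC c x s k hval
  have hsurj' : Function.Surjective toDualP' := by
    intro χ'
    obtain ⟨x, hx⟩ := hS (χ'.comp (QuotientAddGroup.mk' K₀)) (fun s hs => by
      rw [AddMonoidHom.comp_apply, QuotientAddGroup.mk'_apply, (QuotientAddGroup.eq_zero_iff s).2 ((hK₀ s).2 hs),
        map_zero])
    refine ⟨x, ?_⟩
    apply QuotientAddGroup.addMonoidHom_ext
    ext s
    rw [AddMonoidHom.comp_apply, QuotientAddGroup.mk'_apply, hlift, hx, AddMonoidHom.comp_apply,
      QuotientAddGroup.mk'_apply]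
  have hcolφ' : ∀ x : P₀, col x = 0 → ∀ s : W.selmerInfty κ, toDualP' x (φ s) = 0 := by
    intro x hx s
    rw [hφapply, hlift]
    exact hcolφ x hx s
  have hrecG' : ∀ g ∈ G, ∀ s : W.selmerInfty κ, toDualP' (ℓ₀ g) (φ s) = 0 := by
    intro g hg s
    rw [hφapply, hlift]
    exact hrecG g hg s
  exact zetaColemanMuTheta_invol_datum_of_adjointPairing_locOne_erl D Y I G hG v₂ hv₂ ψm ψ hψ₁ hψ₂ toDualP' hT' hC'
    hsurj' col φ hφ hφ₁ hcolφ' ℓ₀ hrecG' herl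

end PerDatum

/-! ## §2 The `loc₂`-pairing ∀-supply on the `Δ < 0` cell ⇒ F1μι⁻ BY NAME ⇒ the crux BY NAME -/

section LocNeg

-- The `loc₂`-PAIRING ∀-supply `hlocNeg` RESTRICTED TO `Δ < 0` (sign binder first; every place `v₂ ∋ 2`, there is exactly one) is the
-- explicit first hypothesis of each theorem below: a hypothesis (the typed inputs at `2`), not a definition.
/-- **The `loc₂`-pairing `Δ < 0` supply gives F1μι⁻ = `ZetaColemanMuIotaNegDiscAtTwo` BY NAME** (the lead's displayed text,
p693557; the P8′ F1 conjunct), per datum by `zetaColemanMuTheta_invol_datum_of_locPairing_erl` at the place of `ℚ` above `2`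
(`Rat.HeightOneSpectrum.primesEquiv`). Kernel; the supply is the OPEN content; nothing asserted.
[cite: Kato2004Asterisque, Thm 12.6 (p. 222), (14.9.3) (p. 240), Thm 16.6 (2) (p. 271), Prop 17.11, Lemma 17.12 (pp. 277–279), §17.13 (pp. 279–280)]
[cite: MilneADT2006, Ch. I, Cor. 2.3] [cite: GreenbergLNM1716, §2 (p. 72)] -/
theorem zetaColemanMuIotaNegDiscAtTwo_of_locPairings_negDisc
    (hlocNeg : ∀ (W : WeierstrassCurve ℚ) [W.IsElliptic] [W.IsGloballyMinimal]
    [ContinuousSMul ℤ_[2] (W.tateModule 2)] [Module.Free ℤ_[2] (W.tateModule 2)]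
    [Module.Finite ℤ_[2] (W.tateModule 2)] {N : ℕ} [NeZero N] (f : CuspForm (Gamma0 N) 2)
    (κ : ZpExtension ℚ 2) (γ : absoluteGaloisGroup ℚ) (hκ : κ.IsCyclotomic),
    W.Δ < 0 → IsOrdinaryAt W 2 → W.HasSurjectiveModNGaloisRep 2 →
    κ.IsTopGenerator γ → IsCyclotomicVariable 2 γ → IsNewformOf W f →
    ∀ (v₂ : HeightOneSpectrum (𝓞 ℚ)), ((2 : ℕ) : 𝓞 ℚ) ∈ v₂.asIdeal →
    ∀ (D : W.SelmerDualData κ γ),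
      ∃ (I : IwasawaH1Data W 2 κ γ) (G : Set I.H)
        (P₀ : Type) (_ : AddCommGroup P₀) (_ : Module (IwasawaAlgebra 2) P₀)
        (toDualP : P₀ →+ (W.subgroupH1 2 κ.kerSubgroup →+ AddCircle (1 : ℚ)))
        (col : P₀ →ₗ[IwasawaAlgebra 2] IwasawaAlgebra 2) (ℓ₀ : I.H →ₗ[IwasawaAlgebra 2] P₀),
        (∀ g ∈ G, IsEulerSystemClassTwo W hκ I g) ∧
        (∀ (x : P₀) (s : W.subgroupH1 2 κ.kerSubgroup),
          W.resOfLe 2 (inf_le_left : κ.kerSubgroup ⊓ decomp v₂ ≤ κ.kerSubgroup) s = 0 → toDualP x s = 0) ∧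
        (∀ (x : P₀) (s : W.subgroupH1 2 κ.kerSubgroup),
          toDualP ((PowerSeries.X : IwasawaAlgebra 2) • x) s =
            toDualP x (W.conjH1 2 κ.kerSubgroup γ⁻¹ s) - toDualP x s) ∧
        (∀ (c : ℤ_[2]) (x : P₀) (s : W.subgroupH1 2 κ.kerSubgroup) (k : ℕ), 2 ^ k • toDualP x s = 0 →
          toDualP (PowerSeries.C c • x) s = (PadicInt.toZModPow k c).val • toDualP x s) ∧
        (∀ χ : W.subgroupH1 2 κ.kerSubgroup →+ AddCircle (1 : ℚ),
          (∀ s, W.resOfLe 2 (inf_le_left : κ.kerSubgroup ⊓ decomp v₂ ≤ κ.kerSubgroup) s = 0 → χ s = 0) →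
            ∃ x : P₀, toDualP x = χ) ∧
        (∀ x : P₀, col x = 0 → ∀ s : W.selmerInfty κ, toDualP x s = 0) ∧
        (∀ g ∈ G, ∀ s : W.selmerInfty κ, toDualP (ℓ₀ g) s = 0) ∧
        ∃ g ∈ G, ∃ (u : (IwasawaAlgebra 2)ˣ) (M L' : IwasawaAlgebra 2) (r : ℚ_[2]),
          M ∉ IwasawaAlgebra.augIdealP 2 ∧ ‖r‖ = 1 ∧
            iwasawaToPowerSeries 2 L' = PowerSeries.C r * padicLFunction f (unitRoot W 2 : ℚ_[2]) ∧
            col (ℓ₀ g) = (u : IwasawaAlgebra 2) * M * L') :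
    ZetaColemanMuIotaNegDiscAtTwo := by
  intro W _ _ _ _ _ N _ f κ γ hκ hord h2 hΔ hγ hγ' hf D Y
  obtain ⟨v₂, hv₂⟩ : ∃ v : HeightOneSpectrum (𝓞 ℚ), ((2 : ℕ) : 𝓞 ℚ) ∈ v.asIdeal :=
    ⟨(Rat.HeightOneSpectrum.primesEquiv (R := 𝓞 ℚ)).symm ⟨2, Nat.prime_two⟩,
      (natCast_mem_asIdeal_iff_eq_primesEquiv_symm _ Nat.prime_two).mpr rfl⟩
  obtain ⟨I, G, P₀, instP₀, instP₀', toDualP, col, ℓ₀, hG, hK, hT, hC, hS, hcolφ, hrecG, herl⟩ :=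
    hlocNeg W f κ γ hκ hΔ hord h2 hγ hγ' hf v₂ hv₂ D
  obtain ⟨Z, P, ℓ, τ, π, h⟩ := zetaColemanMuTheta_invol_datum_of_locPairing_erl D Y I G hG v₂ hv₂ toDualP hK hT hC hS
    col hcolφ ℓ₀ hrecG herl
  exact ⟨I, Z, P, ℓ, τ, π, h⟩

/-- **The post-P8′ F1 child `OrdKatoFineZetaAtTwoResidue` (stmt-BirchSwinnertonDyer-24097; route rev 41 text = F1μι⁻ ∧ the direct
`0 < Δ` cell, VERBATIM the lead's two defs) BY NAME from the `loc₂`-pairing `Δ < 0` supply and the `0 < Δ` conjunct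
`OrdKatoHalfAtTwoIsoPosDisc`** (the second conjunct is RESEARCH — «no mechanism yet», lead RELINE (β); it is passed through).
CONDITIONAL; nothing closed. [cite: Kato2004Asterisque, §17.13 (pp. 279–280)] [cite: GreenbergLNM1716, Conj. 1.11 (p. 64) (shape)] -/
theorem ordKatoFineZetaAtTwoResidue_of_locPairings_negDisc_of_posDisc
    (hlocNeg : ∀ (W : WeierstrassCurve ℚ) [W.IsElliptic] [W.IsGloballyMinimal]
    [ContinuousSMul ℤ_[2] (W.tateModule 2)] [Module.Free ℤ_[2] (W.tateModule 2)]
    [Module.Finite ℤ_[2] (W.tateModule 2)] {N : ℕ} [NeZero N] (f : CuspForm (Gamma0 N) 2)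
    (κ : ZpExtension ℚ 2) (γ : absoluteGaloisGroup ℚ) (hκ : κ.IsCyclotomic),
    W.Δ < 0 → IsOrdinaryAt W 2 → W.HasSurjectiveModNGaloisRep 2 →
    κ.IsTopGenerator γ → IsCyclotomicVariable 2 γ → IsNewformOf W f →
    ∀ (v₂ : HeightOneSpectrum (𝓞 ℚ)), ((2 : ℕ) : 𝓞 ℚ) ∈ v₂.asIdeal →
    ∀ (D : W.SelmerDualData κ γ),
      ∃ (I : IwasawaH1Data W 2 κ γ) (G : Set I.H)
        (P₀ : Type) (_ : AddCommGroup P₀) (_ : Module (IwasawaAlgebra 2) P₀)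
        (toDualP : P₀ →+ (W.subgroupH1 2 κ.kerSubgroup →+ AddCircle (1 : ℚ)))
        (col : P₀ →ₗ[IwasawaAlgebra 2] IwasawaAlgebra 2) (ℓ₀ : I.H →ₗ[IwasawaAlgebra 2] P₀),
        (∀ g ∈ G, IsEulerSystemClassTwo W hκ I g) ∧
        (∀ (x : P₀) (s : W.subgroupH1 2 κ.kerSubgroup),
          W.resOfLe 2 (inf_le_left : κ.kerSubgroup ⊓ decomp v₂ ≤ κ.kerSubgroup) s = 0 → toDualP x s = 0) ∧
        (∀ (x : P₀) (s : W.subgroupH1 2 κ.kerSubgroup),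
          toDualP ((PowerSeries.X : IwasawaAlgebra 2) • x) s =
            toDualP x (W.conjH1 2 κ.kerSubgroup γ⁻¹ s) - toDualP x s) ∧
        (∀ (c : ℤ_[2]) (x : P₀) (s : W.subgroupH1 2 κ.kerSubgroup) (k : ℕ), 2 ^ k • toDualP x s = 0 →
          toDualP (PowerSeries.C c • x) s = (PadicInt.toZModPow k c).val • toDualP x s) ∧
        (∀ χ : W.subgroupH1 2 κ.kerSubgroup →+ AddCircle (1 : ℚ),
          (∀ s, W.resOfLe 2 (inf_le_left : κ.kerSubgroup ⊓ decomp v₂ ≤ κ.kerSubgroup) s = 0 → χ s = 0) →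
            ∃ x : P₀, toDualP x = χ) ∧
        (∀ x : P₀, col x = 0 → ∀ s : W.selmerInfty κ, toDualP x s = 0) ∧
        (∀ g ∈ G, ∀ s : W.selmerInfty κ, toDualP (ℓ₀ g) s = 0) ∧
        ∃ g ∈ G, ∃ (u : (IwasawaAlgebra 2)ˣ) (M L' : IwasawaAlgebra 2) (r : ℚ_[2]),
          M ∉ IwasawaAlgebra.augIdealP 2 ∧ ‖r‖ = 1 ∧
            iwasawaToPowerSeries 2 L' = PowerSeries.C r * padicLFunction f (unitRoot W 2 : ℚ_[2]) ∧
            col (ℓ₀ g) = (u : IwasawaAlgebra 2) * M * L')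
    (hPos : OrdKatoHalfAtTwoIsoPosDisc) : OrdKatoFineZetaAtTwoResidue :=
  ⟨zetaColemanMuIotaNegDiscAtTwo_of_locPairings_negDisc hlocNeg, hPos⟩

end LocNeg

end Summit.BirchSwinnertonDyer.BirchSwinnertonDyer.Theorems.SteinbergFibreAtTwo

end
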